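import Mathlib
import Summits.KontsevichZagierPeriods.Zeta5Search.OddTwistReflection
import HarnessLib

/-!
HONEST FRAMING: systematic search; no irrationality claim unless certified.

# The twisted Pochhammer: parity factorisation and its integer / half-integer zeros

Companion to `OddTwistReflection.lean` (fam-odd gen-2, `families/odd/TWISTED-LEMMA19.md` §1).  For the numerator
`twistNum h₀ e t = ∏_{i=0}^{2h₀+4e} (2t − 2e + i)` of the twisted very-well-poised family T
[Zudilin, SIGMA 14 (2018) 028 = arXiv:1801.09895, (1)–(2); FAMILY.md §5.7] we record, with complete proofs:

* `prod_range_two_mul_add_one` — splitting a product over `range (2N+1)` into its even- and odd-indexed parts;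
* `twistNum_factor` — TWISTED-LEMMA19 (1.1):
  `(2t−2e)_{2h₀+4e+1} = 2^{h₀+2e+1} · ∏_{m=0}^{h₀+2e} (t − e + m) · ∏_{k=0}^{h₀+2e−1} (2t − 2e + 2k + 1)`,
  i.e. an integer run times the odd polynomial `O(t)`; the integer run is what cancels one order of every brick pole;
* `twistNum_intCast_eq_zero` — the numerator vanishes at every INTEGER `t ∈ [−h₀−e, e]`;
* `twistNum_intCast_sub_half_eq_zero` — it vanishes at every HALF-INTEGER `t − ½` with `t ∈ [1−h₀−e, e]`
  (TWISTED-LEMMA19 (1.3): this is why the half-shifted sum F̂ = Σ_{t ≥ e+1} R(t − ½) may be started anywhere in that range).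

Nothing here is an irrationality statement.
-/

namespace Summit.KontsevichZagierPeriods.Zeta5Search

open Finset

/-- Even/odd split of a product over `range (2N+1)`:
`∏_{i<2N+1} f i = (∏_{m<N+1} f (2m)) · ∏_{m<N} f (2m+1)`. -/
theorem prod_range_two_mul_add_one {R : Type*} [CommMonoid R] (f : ℕ → R) (N : ℕ) :
    ∏ i ∈ range (2 * N + 1), f i = (∏ m ∈ range (N + 1), f (2 * m)) * ∏ m ∈ range N, f (2 * m + 1) := by
  induction N with
  | zero => simp
  | succ N ih =>
      rw [show 2 * (N + 1) + 1 = (2 * N + 1) + 1 + 1 from by ring, prod_range_succ, prod_range_succ, ih,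
        prod_range_succ (fun m => f (2 * m)) (N + 1), prod_range_succ (fun m => f (2 * m + 1)) N,
        show 2 * N + 1 + 1 = 2 * (N + 1) from by ring]
      -- both sides are now products of the same four atoms
      set A := ∏ m ∈ range (N + 1), f (2 * m)
      set B := ∏ m ∈ range N, f (2 * m + 1)
      set x := f (2 * N + 1)
      set y := f (2 * (N + 1))
      calc A * B * x * y = A * (B * x) * y := by rw [mul_assoc A B x]
        _ = A * y * (B * x) := by rw [mul_assoc, mul_comm (B * x) y, ← mul_assoc]

/-- TWISTED-LEMMA19 (1.1): the parity factorisation of the twisted Pochhammer,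
`(2t−2e)_{2h₀+4e+1} = 2^{h₀+2e+1} · ∏_{m=0}^{h₀+2e} (t − e + m) · ∏_{k=0}^{h₀+2e−1} (2t − 2e + 2k + 1)`. -/
theorem twistNum_factor (h₀ e : ℕ) (t : ℚ) :
    twistNum h₀ e t
      = 2 ^ (h₀ + 2 * e + 1) * (∏ m ∈ range (h₀ + 2 * e + 1), (t - (e : ℚ) + (m : ℚ)))
          * ∏ m ∈ range (h₀ + 2 * e), (2 * t - 2 * (e : ℚ) + (2 * (m : ℚ) + 1)) := by
  unfold twistNum
  rw [show 2 * h₀ + 4 * e + 1 = 2 * (h₀ + 2 * e) + 1 from by ring, prod_range_two_mul_add_one]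
  have h1 : ∏ m ∈ range (h₀ + 2 * e + 1), (2 * t - 2 * (e : ℚ) + ((2 * m : ℕ) : ℚ))
      = 2 ^ (h₀ + 2 * e + 1) * ∏ m ∈ range (h₀ + 2 * e + 1), (t - (e : ℚ) + (m : ℚ)) := by
    calc ∏ m ∈ range (h₀ + 2 * e + 1), (2 * t - 2 * (e : ℚ) + ((2 * m : ℕ) : ℚ))
        = ∏ m ∈ range (h₀ + 2 * e + 1), ((2 : ℚ) * (t - (e : ℚ) + (m : ℚ))) :=
          prod_congr rfl (fun m _ => by push_cast; ring)
      _ = 2 ^ (h₀ + 2 * e + 1) * ∏ m ∈ range (h₀ + 2 * e + 1), (t - (e : ℚ) + (m : ℚ)) := by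
          rw [prod_mul_distrib, prod_const, card_range]
  have h2 : ∏ m ∈ range (h₀ + 2 * e), (2 * t - 2 * (e : ℚ) + ((2 * m + 1 : ℕ) : ℚ))
      = ∏ m ∈ range (h₀ + 2 * e), (2 * t - 2 * (e : ℚ) + (2 * (m : ℚ) + 1)) :=
    prod_congr rfl (fun m _ => by push_cast; ring)
  rw [h1, h2]

/-- The twisted Pochhammer vanishes at every integer `t` with `−h₀ − e ≤ t ≤ e`
(generalises `twistNum_natCast_eq_zero`, which is the case `0 ≤ t ≤ e`). -/
theorem twistNum_intCast_eq_zero (h₀ e : ℕ) (t : ℤ) (h1 : -(h₀ : ℤ) - e ≤ t) (h2 : t ≤ e) :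
    twistNum h₀ e (t : ℚ) = 0 := by
  unfold twistNum
  obtain ⟨i, hi⟩ : ∃ i : ℕ, (i : ℤ) = 2 * (e : ℤ) - 2 * t :=
    ⟨(2 * (e : ℤ) - 2 * t).toNat, Int.toNat_of_nonneg (by omega)⟩
  apply prod_eq_zero (i := i) (mem_range.mpr (by omega))
  have hi' : (i : ℚ) = 2 * (e : ℚ) - 2 * (t : ℚ) := by exact_mod_cast hi
  rw [hi']; ring

/-- TWISTED-LEMMA19 (1.3): the twisted Pochhammer vanishes at the half-integers `t − ½` for every integer
`t` with `1 − h₀ − e ≤ t ≤ e` (so `R(t − ½) = 0` there and F̂ = Σ_{t ≥ e+1} R(t − ½) = Σ_{t ≥ 1−c} R(t − ½) for any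
`c ∈ [−e, h₀ + e]`). -/
theorem twistNum_intCast_sub_half_eq_zero (h₀ e : ℕ) (t : ℤ) (h1 : 1 - (h₀ : ℤ) - e ≤ t) (h2 : t ≤ e) :
    twistNum h₀ e ((t : ℚ) - 1 / 2) = 0 := by
  unfold twistNum
  obtain ⟨i, hi⟩ : ∃ i : ℕ, (i : ℤ) = 2 * (e : ℤ) + 1 - 2 * t :=
    ⟨(2 * (e : ℤ) + 1 - 2 * t).toNat, Int.toNat_of_nonneg (by omega)⟩
  apply prod_eq_zero (i := i) (mem_range.mpr (by omega))
  have hi' : (i : ℚ) = 2 * (e : ℚ) + 1 - 2 * (t : ℚ) := by exact_mod_cast hi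
  rw [hi']; ring

/-- Consequence for the summand: `R(t − ½) = 0` at those half-integers (any brick data). -/
theorem twistCore_intCast_sub_half_eq_zero (q h₀ e : ℕ) (h : Fin q → ℕ) (t : ℤ)
    (h1 : 1 - (h₀ : ℤ) - e ≤ t) (h2 : t ≤ e) :
    twistCore q h₀ e h ((t : ℚ) - 1 / 2) = 0 := by
  unfold twistCore
  rw [twistNum_intCast_sub_half_eq_zero h₀ e t h1 h2, zero_div]

/-! Sanity: h₀ = 1, e = 0: twistNum 1 0 t = (2t)(2t+1)(2t+2) = 2^2 · t(t+1) · (2t+1). -/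
example (t : ℚ) : twistNum 1 0 t = 2 ^ 2 * (t * (t + 1)) * (2 * t + 1) := by
  rw [twistNum_factor]; norm_num [prod_range_succ]

end Summit.KontsevichZagierPeriods.Zeta5Search
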